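import Summits.CriticalPhenomena.SAWScalingLimit.Theorems.SAWRenewalTightnessSubseqIdentificationTiltedProductCell
import Literature.Probability.RandomPlanarGeometry.SLEImageBracketCell
import HarnessLib

/-!
# The tilted martingale identities (line `boundary-area-law`, RS5b′/T2, Σ): the bracket cell

Line `boundary-area-law` of the crux `SubseqIdentification` (stmt-CriticalPhenomena-0783), restriction
reshape (lead c4, r-c4-5), stub `stub_tiltedBracketMartingale` (Σ) = the bracket half of step (T2) of
the tilted [LSW] Theorem 6.5 (G. F. Lawler, O. Schramm, W. Werner, *Conformal restriction: the chordal
case*, J. Amer. Math. Soc. **16** (2003), §5 (5.1)–(5.3) and Prop. 5.3): for `0 < κ ≤ 8/3`,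
`α = (6−κ)/(2κ)`, `λ = (8−3κ)(6−κ)/(2κ)`, a nonempty `*`-hull `A` and levels `n ≤ k`, the product
`Zⁿ · Lᵏ` of the compensated square `Zⁿ = (Mⁿ)² − κ Cⁿ` of the localised image driving function
`Mⁿ = imgMartK κ hA hne n` (`W̃ = h_t(W_t)` stopped at `imgLocTimeK n`, clock
`Cⁿ = imgClockK κ hA hne n = ∫₀^{·∧τₙ} Φ′_{B_s}(0)² ds`) with the localised compensated restriction
martingale `Lᵏ = locMartK κ α λ hA hne k` is a martingale: in print
`d(ZL) = Z dL + L dZ + d⟨Z, L⟩`, `dZ = 2W̃ dW̃ + (d⟨W̃⟩ − κ h′(W)² dt)`, and the `dt`-terms are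
`2 W̃ L h″(W) (κ/2 − 3 + κα) = 0` (`κα = 3 − κ/2`) — the bracket identity `d⟨W̃⟩ = κ h′(W)² dt` survives
the tilt.

The pathwise cell (CELL SCHEME, no stochastic calculus; twin of `…TiltedProductCell` with `Mⁿ`
replaced by `Zⁿ`, after `SLEImageBracketCell`). Over a cell `[u, u + h]`, for `S ∈ 𝓕_s`, `s ≤ u`, with
`g₀ = 𝟙_S 𝟙{u < imgLocTimeK n}`, `E_u = e^{−λ Iᵏ_u}`, `ΔW̃ = imageDrvFnK_{u+h} − imageDrvFnK_u`,
`Ŷ′ = D_{u+h}^α e^{−λ∫ᵤ^{u+h} m}`, `d = Φ′_{B_u}(0)`: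

  `𝟙_S (Z_{u+h} L_{u+h} − Z_u L_u) = 𝟙_S Z_u (L_{u+h} − L_u) + g₀ E_u ((ΔW̃)² Ŷ′ − κ d² d^α h)`
  `  + 2 (g₀ E_u Mⁿ_u) (ΔW̃ Ŷ′) − κ h (g₀ E_u d²) (Ŷ′ − d^α) + g₀ · defect`

(`indicator_brk_sub_eq`): the past term integrates to zero exactly (`integral_brkPast_mul_sub_eq_zero`), the
three middle terms are conditional one-step moments against `𝓕_u`-weights (second moment of `ΔW̃ · Ŷ′_{α/2,λ/2}`,
first moment with the vanishing coefficient, `Y`-increment), and the defect is small pathwise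
(`abs_brkDefect_le`): `2κ h · cellErr` on interior cells (the clock increment, `abs_imgClockK_sub_sub_le`),
`O(h² + κ₀²)` on the boundary cell `{u < imgLocTimeK n < u + h}`, and a quadratic polynomial of the running
supremum on the event of large driver oscillation.

References: [LSW] §5 (5.1)–(5.3), Prop. 5.3; G. F. Lawler, O. Schramm, W. Werner, Acta Math. **187** (2001),
Thm. 2.2 (the bracket at `κ = 6`). No named fact is used.
-/

noncomputable section

open MeasureTheory Filter Topology Set Metric Function
open scoped NNReal ENNReal
open Literature.Probability.RandomPlanarGeometry
open Literature.Probability.Process (preWienerMeasure runSup runSup_nonneg integrable_runSup)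

namespace Summit.CriticalPhenomena.SAWScalingLimit.Theorems.SubseqIdentification.BoundaryAreaLaw

open Loewner PathOps

/-! ### The pathwise cell decomposition of `Zⁿ · Lᵏ` -/

section Pathwise

variable {κ : ℝ≥0} {α lam : ℝ} {A : Set ℂ} {hA : IsStarHull A} {hne : A.Nonempty} {n k : ℕ}

/-- After the localising time both `Mⁿ` and the clock `Cⁿ` are frozen: if `¬ (u < imgLocTimeK n)` then
`Mⁿ_{u+h} = Mⁿ_u` and `Cⁿ_{u+h} = Cⁿ_u`. [folklore] -/
theorem brk_frozen_of_not_lt {u h : ℝ≥0} {ω : ℝ≥0 → ℝ} (h2 : ¬ (u : WithTop ℝ≥0) < imgLocTimeK κ hA hne n ω) :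
    imgMartK κ hA hne n (u + h) ω = imgMartK κ hA hne n u ω ∧
      imgClockK κ hA hne n (u + h) ω = imgClockK κ hA hne n u ω := by
  -- adapted from SLEImageBracketCell.lean (`indicator_imgBracket_sub_eq`)
  obtain ⟨T₀, hT₀⟩ := WithTop.ne_top_iff_exists.1 (imgLocTimeK_ne_top (κ := κ) (hA := hA) (hne := hne) n ω)
  have hTu : T₀ ≤ u := by
    have := not_lt.1 h2; rw [← hT₀] at this; exact_mod_cast this
  refine ⟨by rw [imgMartK_eq_of_ge hT₀.symm (hTu.trans le_self_add), imgMartK_eq_of_ge hT₀.symm hTu], ?_⟩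
  rw [imgClockK_eq_timeIntegral_min, imgClockK_eq_timeIntegral_min, ← hT₀,
    min_eq_right (by exact_mod_cast (hTu.trans le_self_add) : ((T₀ : ℝ≥0) : WithTop ℝ≥0) ≤ (u + h : ℝ≥0)),
    min_eq_right (by exact_mod_cast hTu : ((T₀ : ℝ≥0) : WithTop ℝ≥0) ≤ (u : ℝ≥0))]

/-- **The bracket cell decomposition** (pathwise identity): with `g₀ = 𝟙_S 𝟙{u < imgLocTimeK n}`,
`E_u = e^{−λ Iᵏ_u}`, `ΔW̃ = imageDrvFnK_{u+h} − imageDrvFnK_u`, `Ŷ′ = D_{u+h}^α e^{−λ ∫ᵤ^{u+h} m}`, `d = Φ′_{B_u}(0)`: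
`𝟙_S (Z_{u+h} L_{u+h} − Z_u L_u) = 𝟙_S Z_u (L_{u+h} − L_u) + g₀ E_u ((ΔW̃)² Ŷ′ − κ d² d^α h) + 2 (g₀ E_u M_u)(ΔW̃ Ŷ′)`
`− κ h (g₀ E_u d²)(Ŷ′ − d^α) + g₀ · defect` (after `imgLocTimeK n` the process `Zⁿ` is frozen). [folklore] -/
theorem indicator_brk_sub_eq (S : Set (ℝ≥0 → ℝ)) (u h : ℝ≥0) (ω : ℝ≥0 → ℝ) :
    S.indicator (fun ω ↦ (imgMartK κ hA hne n (u + h) ω ^ 2 - κ * imgClockK κ hA hne n (u + h) ω) *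
          locMartK κ α lam hA hne k (u + h) ω -
        (imgMartK κ hA hne n u ω ^ 2 - κ * imgClockK κ hA hne n u ω) * locMartK κ α lam hA hne k u ω) ω =
      S.indicator (fun _ ↦ (1 : ℝ)) ω * (imgMartK κ hA hne n u ω ^ 2 - κ * imgClockK κ hA hne n u ω) *
          (locMartK κ α lam hA hne k (u + h) ω - locMartK κ α lam hA hne k u ω) +
        (S.indicator (fun _ ↦ (1 : ℝ)) ω * {ω | (u : WithTop ℝ≥0) < imgLocTimeK κ hA hne n ω}.indicator (fun _ ↦ (1 : ℝ)) ω *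
            Real.exp (-(lam * IpnK κ hA hne k u ω))) *
          ((imageDrvFnK κ A (u + h) (brownianCPath ω) - imageDrvFnK κ A u (brownianCPath ω)) ^ 2 *
              (DFnK κ A (u + h) (brownianCPath ω) ^ α * Real.exp (-(lam * JFnK κ A u h (brownianCPath ω)))) -
            κ * starDeriv (slidHull (drvK κ (brownianCPath ω)) A u) ^ 2 *
              starDeriv (slidHull (drvK κ (brownianCPath ω)) A u) ^ α * h) +
        2 * (S.indicator (fun _ ↦ (1 : ℝ)) ω * {ω | (u : WithTop ℝ≥0) < imgLocTimeK κ hA hne n ω}.indicator (fun _ ↦ (1 : ℝ)) ω *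
            Real.exp (-(lam * IpnK κ hA hne k u ω)) * imgMartK κ hA hne n u ω) *
          ((imageDrvFnK κ A (u + h) (brownianCPath ω) - imageDrvFnK κ A u (brownianCPath ω)) *
            (DFnK κ A (u + h) (brownianCPath ω) ^ α * Real.exp (-(lam * JFnK κ A u h (brownianCPath ω))))) -
        κ * h * (S.indicator (fun _ ↦ (1 : ℝ)) ω * {ω | (u : WithTop ℝ≥0) < imgLocTimeK κ hA hne n ω}.indicator (fun _ ↦ (1 : ℝ)) ω *
            Real.exp (-(lam * IpnK κ hA hne k u ω)) * starDeriv (slidHull (drvK κ (brownianCPath ω)) A u) ^ 2 *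
          (DFnK κ A (u + h) (brownianCPath ω) ^ α * Real.exp (-(lam * JFnK κ A u h (brownianCPath ω))) -
            starDeriv (slidHull (drvK κ (brownianCPath ω)) A u) ^ α)) +
        (S.indicator (fun _ ↦ (1 : ℝ)) ω * {ω | (u : WithTop ℝ≥0) < imgLocTimeK κ hA hne n ω}.indicator (fun _ ↦ (1 : ℝ)) ω) *
          (((imgMartK κ hA hne n (u + h) ω ^ 2 - κ * imgClockK κ hA hne n (u + h) ω) -
                (imgMartK κ hA hne n u ω ^ 2 - κ * imgClockK κ hA hne n u ω)) * locMartK κ α lam hA hne k (u + h) ω -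
              Real.exp (-(lam * IpnK κ hA hne k u ω)) *
                ((imageDrvFnK κ A (u + h) (brownianCPath ω) - imageDrvFnK κ A u (brownianCPath ω)) ^ 2 *
                    (DFnK κ A (u + h) (brownianCPath ω) ^ α * Real.exp (-(lam * JFnK κ A u h (brownianCPath ω)))) -
                  κ * starDeriv (slidHull (drvK κ (brownianCPath ω)) A u) ^ 2 *
                    starDeriv (slidHull (drvK κ (brownianCPath ω)) A u) ^ α * h) -
              2 * Real.exp (-(lam * IpnK κ hA hne k u ω)) * imgMartK κ hA hne n u ω *
                ((imageDrvFnK κ A (u + h) (brownianCPath ω) - imageDrvFnK κ A u (brownianCPath ω)) *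
                  (DFnK κ A (u + h) (brownianCPath ω) ^ α * Real.exp (-(lam * JFnK κ A u h (brownianCPath ω))))) +
            κ * h * (Real.exp (-(lam * IpnK κ hA hne k u ω)) * starDeriv (slidHull (drvK κ (brownianCPath ω)) A u) ^ 2 *
              (DFnK κ A (u + h) (brownianCPath ω) ^ α * Real.exp (-(lam * JFnK κ A u h (brownianCPath ω))) -
                starDeriv (slidHull (drvK κ (brownianCPath ω)) A u) ^ α))) := by
  -- adapted from SLEImageBracketCell.lean (`indicator_imgBracket_sub_eq`) and …TiltedProductCell (`indicator_prod_sub_eq`)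
  by_cases h1 : ω ∈ S
  · rw [Set.indicator_of_mem h1, Set.indicator_of_mem h1]
    by_cases h2 : (u : WithTop ℝ≥0) < imgLocTimeK κ hA hne n ω
    · rw [Set.indicator_of_mem (show ω ∈ {ω | (u : WithTop ℝ≥0) < imgLocTimeK κ hA hne n ω} from h2)]; ring
    · rw [Set.indicator_of_notMem (show ω ∉ {ω | (u : WithTop ℝ≥0) < imgLocTimeK κ hA hne n ω} from h2)]
      obtain ⟨eM, eC⟩ := brk_frozen_of_not_lt (h := h) h2
      rw [eM, eC]; ring
  · rw [Set.indicator_of_notMem h1, Set.indicator_of_notMem h1]; ring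

/-- **The defect of the bracket cell, pointwise.** On `{u < imgLocTimeK n}` (`n ≤ k`), with `A ⊆ B̄(0, R)`,
`u ≤ t₁`, `h ≤ 1`, a threshold `κ₀ > 0` with `stepSize κ₀ h ≤ cₙ(cₙ/16)/1000`, `Bad = {κ₀/σ ≤ osc_h(incr_u β)}`,
`E = {u < imgLocTimeK n < u + h}`, `D = 50h/(cₙ/16) + 4κ₀`, `N₀` the bound of `Mⁿ`, `Q = 15080√(t₁+1) + 1160R`,
`M₁ = 3482√κ`, `X = runSup (u+h)`:
`|defect| ≤ 𝟙_E (3D² + 4N₀D + 2κh) + 2κ h cellErr + 𝟙_Bad (2N₀² + 3κ + 2Q² + 2N₀Q) + 𝟙_Bad X (2N₀M₁) + 𝟙_Bad X² (2M₁²)`: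
interior cells only carry the clock error (`prod_locMartK_eq_of_le`, `prod_imgMartK_sub_eq_of_le`,
`abs_imgClockK_sub_sub_le`; `imgLocTimeK n ≤ locTimeK n ≤ locTimeK k`); on a boundary cell with small
oscillation `ΔM, ΔW̃ = O(h/ρ₀ + κ₀)` (`abs_imgMartK_sub_sub_le`, `abs_imageDriver_sub_le_of_lt_imgLocTimeK`) and
`L, E_u Ŷ′ ∈ [0, 1]`, `0 ≤ ΔC ≤ h`. [cite: LawlerSchrammWerner2003Restriction, §5 (5.1)–(5.3) and Prop. 5.3] -/
theorem abs_brkDefect_le (hκ : κ ≤ 8 / 3) (hα : 0 < α) (hlam : 0 ≤ lam) (hnk : n ≤ k) {R : ℝ} (hR0 : 0 < R)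
    (hAR : A ⊆ closedBall (0 : ℂ) R) {u h t₁ : ℝ≥0} (hut : u ≤ t₁) (hh0 : 0 < h) (hh1 : (h : ℝ) ≤ 1) {κ₀ : ℝ}
    (hκ₀ : 0 < κ₀) (hh2 : stepSize κ₀ h ≤ locLevel n * (locLevel n / 16) / 1000) {ω : ℝ≥0 → ℝ}
    (hu : (u : WithTop ℝ≥0) < imgLocTimeK κ hA hne n ω) :
    |((imgMartK κ hA hne n (u + h) ω ^ 2 - κ * imgClockK κ hA hne n (u + h) ω) -
            (imgMartK κ hA hne n u ω ^ 2 - κ * imgClockK κ hA hne n u ω)) * locMartK κ α lam hA hne k (u + h) ω -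
          Real.exp (-(lam * IpnK κ hA hne k u ω)) *
            ((imageDrvFnK κ A (u + h) (brownianCPath ω) - imageDrvFnK κ A u (brownianCPath ω)) ^ 2 *
                (DFnK κ A (u + h) (brownianCPath ω) ^ α * Real.exp (-(lam * JFnK κ A u h (brownianCPath ω)))) -
              κ * starDeriv (slidHull (drvK κ (brownianCPath ω)) A u) ^ 2 *
                starDeriv (slidHull (drvK κ (brownianCPath ω)) A u) ^ α * h) -
          2 * Real.exp (-(lam * IpnK κ hA hne k u ω)) * imgMartK κ hA hne n u ω *
            ((imageDrvFnK κ A (u + h) (brownianCPath ω) - imageDrvFnK κ A u (brownianCPath ω)) *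
              (DFnK κ A (u + h) (brownianCPath ω) ^ α * Real.exp (-(lam * JFnK κ A u h (brownianCPath ω))))) +
        κ * h * (Real.exp (-(lam * IpnK κ hA hne k u ω)) * starDeriv (slidHull (drvK κ (brownianCPath ω)) A u) ^ 2 *
          (DFnK κ A (u + h) (brownianCPath ω) ^ α * Real.exp (-(lam * JFnK κ A u h (brownianCPath ω))) -
            starDeriv (slidHull (drvK κ (brownianCPath ω)) A u) ^ α))| ≤
      {ω | (u : WithTop ℝ≥0) < imgLocTimeK κ hA hne n ω ∧ imgLocTimeK κ hA hne n ω < ((u + h : ℝ≥0) : WithTop ℝ≥0)}.indicator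
          (fun _ ↦ 3 * (50 * (h : ℝ) / (locLevel n / 16) + 4 * κ₀) ^ 2 +
            4 * (((n : ℝ) + 1) + 1160 * (3 * ((n : ℝ) + 1) + 13 * Real.sqrt ((n : ℝ) + 1) + R)) *
              (50 * (h : ℝ) / (locLevel n / 16) + 4 * κ₀) + 2 * κ * h) ω +
        2 * κ * h * cellErr n κ₀ h +
        (2 * (((n : ℝ) + 1) + 1160 * (3 * ((n : ℝ) + 1) + 13 * Real.sqrt ((n : ℝ) + 1) + R)) ^ 2 + 3 * κ +
              2 * (15080 * Real.sqrt ((t₁ : ℝ) + 1) + 1160 * R) ^ 2 +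
            2 * (((n : ℝ) + 1) + 1160 * (3 * ((n : ℝ) + 1) + 13 * Real.sqrt ((n : ℝ) + 1) + R)) *
              (15080 * Real.sqrt ((t₁ : ℝ) + 1) + 1160 * R)) *
          {ω | κ₀ / stepSigma ≤ oscFn h (incr u (brownianCPath ω))}.indicator (fun _ ↦ (1 : ℝ)) ω +
        2 * (((n : ℝ) + 1) + 1160 * (3 * ((n : ℝ) + 1) + 13 * Real.sqrt ((n : ℝ) + 1) + R)) * (3482 * Real.sqrt κ) *
          ({ω | κ₀ / stepSigma ≤ oscFn h (incr u (brownianCPath ω))}.indicator (fun _ ↦ (1 : ℝ)) ω * runSup (u + h) ω) +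
        2 * (3482 * Real.sqrt κ) ^ 2 *
          ({ω | κ₀ / stepSigma ≤ oscFn h (incr u (brownianCPath ω))}.indicator (fun _ ↦ (1 : ℝ)) ω * runSup (u + h) ω ^ 2) := by
  -- adapted from SLEImageBracketCell.lean (`abs_imgBracketDefect_le`) and …TiltedProductCell (`abs_prodDefect_le`)
  have hc0 := (locLevel_pos_le n).1
  have hσ := stepSigma_pos
  have hκ0' : (0 : ℝ) ≤ κ := κ.coe_nonneg
  have h0 : (0 : WithTop ℝ≥0) < imgLocTimeK κ hA hne n ω := lt_of_le_of_lt bot_le hu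
  have hτT : imgLocTimeK κ hA hne n ω ≤ locTimeK κ hA hne k ω :=
    (imgLocTimeK_le_locTimeK n ω).trans (monotone_locTimeK ω hnk)
  have hT0 : (0 : WithTop ℝ≥0) < locTimeK κ hA hne k ω := h0.trans_le hτT
  -- names
  set N₀ : ℝ := ((n : ℝ) + 1) + 1160 * (3 * ((n : ℝ) + 1) + 13 * Real.sqrt ((n : ℝ) + 1) + R) with hN₀
  set Q : ℝ := 15080 * Real.sqrt ((t₁ : ℝ) + 1) + 1160 * R with hQ
  set M₁ : ℝ := 3482 * Real.sqrt κ with hM₁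
  set D : ℝ := 50 * (h : ℝ) / (locLevel n / 16) + 4 * κ₀ with hD
  set X : ℝ := runSup (u + h) ω with hX
  set Mu : ℝ := imgMartK κ hA hne n u ω with hMu
  set ΔM : ℝ := imgMartK κ hA hne n (u + h) ω - imgMartK κ hA hne n u ω with hΔM
  set ΔC : ℝ := imgClockK κ hA hne n (u + h) ω - imgClockK κ hA hne n u ω with hΔC
  set L : ℝ := locMartK κ α lam hA hne k (u + h) ω with hL
  set Eu : ℝ := Real.exp (-(lam * IpnK κ hA hne k u ω)) with hEu
  set ΔΦ : ℝ := imageDrvFnK κ A (u + h) (brownianCPath ω) - imageDrvFnK κ A u (brownianCPath ω) with hΔΦ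
  set Yh : ℝ := DFnK κ A (u + h) (brownianCPath ω) ^ α * Real.exp (-(lam * JFnK κ A u h (brownianCPath ω))) with hYh
  set d : ℝ := starDeriv (slidHull (drvK κ (brownianCPath ω)) A u) with hd
  have hX0 : 0 ≤ X := runSup_nonneg _ ω
  have hN₀0 : 0 ≤ N₀ := by positivity
  have hQ0 : 0 ≤ Q := by positivity
  have hM₁0 : 0 ≤ M₁ := by positivity
  have hD0 : 0 ≤ D := by positivity
  have hce0 : 0 ≤ cellErr n κ₀ h := by rw [cellErr, stepSize]; positivity
  have hDv0 : 0 ≤ 3 * D ^ 2 + 4 * N₀ * D + 2 * κ * h := by positivity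
  have hE0 := Set.indicator_nonneg (fun _ _ ↦ hDv0)
    (s := {ω | (u : WithTop ℝ≥0) < imgLocTimeK κ hA hne n ω ∧ imgLocTimeK κ hA hne n ω < ((u + h : ℝ≥0) : WithTop ℝ≥0)}) ω
  -- ranges of the factors
  obtain ⟨hd0, hd1⟩ := starDeriv_pos_le_one (slidHull (drvK κ (brownianCPath ω)) A u)
  have hdα0 : 0 ≤ d ^ α := Real.rpow_nonneg hd0.le _
  have hdα1 : d ^ α ≤ 1 := Real.rpow_le_one hd0.le hd1 hα.le
  have hd2 : d ^ 2 ≤ 1 := pow_le_one₀ hd0.le hd1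
  have hL01 : 0 ≤ L ∧ L ≤ 1 := locMartK_mem_Icc (κ := κ) (hA := hA) (hne := hne) (n := k) hα hlam (u + h) ω
  have hEu01 : 0 ≤ Eu ∧ Eu ≤ 1 :=
    ⟨(Real.exp_pos _).le, by rw [hEu, Real.exp_le_one_iff, neg_nonpos]; exact mul_nonneg hlam (IpnK_nonneg k u ω)⟩
  have hYh01 : 0 ≤ Yh ∧ Yh ≤ 1 := by
    obtain ⟨-, -, e0, e1⟩ := DFnK_eq (κ := κ) (A := A) (u + h) (brownianCPath ω)
    have c1 : Real.exp (-(lam * JFnK κ A u h (brownianCPath ω))) ≤ 1 := by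
      rw [Real.exp_le_one_iff, neg_nonpos]; exact mul_nonneg hlam (JFnK_nonneg hA u h _)
    exact ⟨mul_nonneg (Real.rpow_nonneg e0 _) (Real.exp_pos _).le,
      mul_le_one₀ (Real.rpow_le_one e0 e1 hα.le) (Real.exp_pos _).le c1⟩
  have hEY01 : 0 ≤ Eu * Yh ∧ Eu * Yh ≤ 1 := ⟨mul_nonneg hEu01.1 hYh01.1, mul_le_one₀ hEu01.2 hYh01.1 hYh01.2⟩
  have hMuN : |Mu| ≤ N₀ := abs_imgMartK_le (κ := κ) (hA := hA) (hne := hne) (n := n) hR0 hAR u ω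
  have hMhN : |imgMartK κ hA hne n (u + h) ω| ≤ N₀ := abs_imgMartK_le (κ := κ) (hA := hA) (hne := hne) (n := n) hR0 hAR _ ω
  have hΔC01 : 0 ≤ ΔC ∧ ΔC ≤ h := by
    obtain ⟨-, hcm⟩ := imgClockK_sub_mem (κ := κ) (hA := hA) (hne := hne) (n := n) (le_self_add : u ≤ u + h) ω
    refine ⟨by have := hcm.1; rw [hΔC]; exact this, ?_⟩
    have := hcm.2; push_cast at this; rw [hΔC]; linarith
  have hκh : (κ : ℝ) * h ≤ κ := mul_le_of_le_one_right hκ0' hh1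
  have hYd : |Yh - d ^ α| ≤ 1 := by rw [abs_le]; constructor <;> linarith [hYh01.1, hYh01.2]
  -- the defect, regrouped
  have hreg : ((imgMartK κ hA hne n (u + h) ω ^ 2 - κ * imgClockK κ hA hne n (u + h) ω) -
        (imgMartK κ hA hne n u ω ^ 2 - κ * imgClockK κ hA hne n u ω)) * L -
        Eu * (ΔΦ ^ 2 * Yh - κ * d ^ 2 * d ^ α * h) - 2 * Eu * Mu * (ΔΦ * Yh) + κ * h * (Eu * d ^ 2 * (Yh - d ^ α)) =
      (2 * Mu * ΔM + ΔM ^ 2) * L - κ * ΔC * L - Eu * Yh * (ΔΦ ^ 2 + 2 * Mu * ΔΦ) + κ * h * (Eu * d ^ 2 * Yh) := by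
    rw [hΔM, hΔC, hMu]; ring
  rw [hreg]
  -- sizes of the four regrouped pieces, valid everywhere
  have p2 : |κ * ΔC * L| ≤ κ * h := by
    rw [abs_mul, abs_mul, abs_of_nonneg hκ0', abs_of_nonneg hΔC01.1, abs_of_nonneg hL01.1]
    calc (κ : ℝ) * ΔC * L ≤ κ * h * 1 := mul_le_mul (mul_le_mul_of_nonneg_left hΔC01.2 hκ0') hL01.2 hL01.1 (by positivity)
      _ = κ * h := mul_one _
  have p4 : |κ * h * (Eu * d ^ 2 * Yh)| ≤ κ * h := by
    rw [abs_mul, abs_of_nonneg (by positivity : (0 : ℝ) ≤ κ * h)]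
    refine mul_le_of_le_one_right (by positivity) ?_
    rw [show Eu * d ^ 2 * Yh = d ^ 2 * (Eu * Yh) by ring, abs_mul, abs_of_nonneg (sq_nonneg _), abs_of_nonneg hEY01.1]
    exact mul_le_one₀ hd2 hEY01.1 hEY01.2
  by_cases hbad : ω ∈ {ω | κ₀ / stepSigma ≤ oscFn h (incr u (brownianCPath ω))}
  · -- large oscillation: the crude bound
    rw [Set.indicator_of_mem hbad, mul_one, one_mul, one_mul]
    have hΔΦle : |ΔΦ| ≤ M₁ * X + Q := by
      have := abs_imageDrvFnK_brownianCPath_sub_leK (κ := κ) hA hR0 hAR u h ω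
      have hsq : Real.sqrt ((u + h : ℝ≥0) : ℝ) ≤ Real.sqrt ((t₁ : ℝ) + 1) :=
        Real.sqrt_le_sqrt (by push_cast; exact add_le_add (by exact_mod_cast hut) hh1)
      rw [hΔΦ, hM₁, hX, hQ]
      linarith [mul_le_mul_of_nonneg_left hsq (by norm_num : (0 : ℝ) ≤ 15080)]
    have p1 : |(2 * Mu * ΔM + ΔM ^ 2) * L| ≤ 2 * N₀ ^ 2 := by
      rw [abs_mul, abs_of_nonneg hL01.1]
      have e1 : |2 * Mu * ΔM + ΔM ^ 2| ≤ 2 * N₀ ^ 2 := by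
        have hsq : 2 * Mu * ΔM + ΔM ^ 2 = imgMartK κ hA hne n (u + h) ω ^ 2 - Mu ^ 2 := by rw [hΔM]; ring
        have a1 : |imgMartK κ hA hne n (u + h) ω ^ 2| ≤ N₀ ^ 2 := by
          rw [abs_of_nonneg (sq_nonneg _), ← sq_abs]; exact pow_le_pow_left₀ (abs_nonneg _) hMhN 2
        have a2 : |Mu ^ 2| ≤ N₀ ^ 2 := by
          rw [abs_of_nonneg (sq_nonneg _), ← sq_abs]; exact pow_le_pow_left₀ (abs_nonneg _) hMuN 2
        rw [hsq]
        calc _ ≤ |imgMartK κ hA hne n (u + h) ω ^ 2| + |Mu ^ 2| := abs_sub _ _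
          _ ≤ N₀ ^ 2 + N₀ ^ 2 := add_le_add a1 a2
          _ = 2 * N₀ ^ 2 := by ring
      calc |2 * Mu * ΔM + ΔM ^ 2| * L ≤ 2 * N₀ ^ 2 * 1 := mul_le_mul e1 hL01.2 hL01.1 (by positivity)
        _ = _ := mul_one _
    have p3 : |Eu * Yh * (ΔΦ ^ 2 + 2 * Mu * ΔΦ)| ≤ (2 * M₁ ^ 2 * X ^ 2 + 2 * Q ^ 2) + 2 * N₀ * (M₁ * X + Q) := by
      rw [abs_mul, abs_of_nonneg hEY01.1]
      have e1 : |ΔΦ ^ 2 + 2 * Mu * ΔΦ| ≤ (2 * M₁ ^ 2 * X ^ 2 + 2 * Q ^ 2) + 2 * N₀ * (M₁ * X + Q) := by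
        have a1 : |ΔΦ ^ 2| ≤ 2 * M₁ ^ 2 * X ^ 2 + 2 * Q ^ 2 := by
          rw [abs_of_nonneg (sq_nonneg _)]
          have h1 : ΔΦ ^ 2 ≤ (M₁ * X + Q) ^ 2 := by rw [← sq_abs]; exact pow_le_pow_left₀ (abs_nonneg _) hΔΦle 2
          have h2 : 2 * M₁ ^ 2 * X ^ 2 + 2 * Q ^ 2 - (M₁ * X + Q) ^ 2 = (M₁ * X - Q) ^ 2 := by ring
          linarith [sq_nonneg (M₁ * X - Q)]
        have a2 : |2 * Mu * ΔΦ| ≤ 2 * N₀ * (M₁ * X + Q) := by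
          rw [abs_mul, abs_mul, abs_two]; exact mul_le_mul (by linarith) hΔΦle (abs_nonneg _) (by positivity)
        exact (abs_add_le _ _).trans (add_le_add a1 a2)
      have e0 : 0 ≤ (2 * M₁ ^ 2 * X ^ 2 + 2 * Q ^ 2) + 2 * N₀ * (M₁ * X + Q) := by positivity
      calc Eu * Yh * |ΔΦ ^ 2 + 2 * Mu * ΔΦ| ≤ 1 * ((2 * M₁ ^ 2 * X ^ 2 + 2 * Q ^ 2) + 2 * N₀ * (M₁ * X + Q)) :=
            mul_le_mul hEY01.2 e1 (abs_nonneg _) zero_le_one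
        _ = _ := one_mul _
    have htot : |(2 * Mu * ΔM + ΔM ^ 2) * L - κ * ΔC * L - Eu * Yh * (ΔΦ ^ 2 + 2 * Mu * ΔΦ) + κ * h * (Eu * d ^ 2 * Yh)| ≤
        2 * N₀ ^ 2 + κ * h + ((2 * M₁ ^ 2 * X ^ 2 + 2 * Q ^ 2) + 2 * N₀ * (M₁ * X + Q)) + κ * h :=
      (abs_add_le _ _).trans (add_le_add ((abs_sub _ _).trans (add_le_add ((abs_sub _ _).trans (add_le_add p1 p2)) p3)) p4)
    have hce : 0 ≤ 2 * (κ : ℝ) * h * cellErr n κ₀ h := by positivity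
    have hring : 2 * N₀ ^ 2 + κ * h + ((2 * M₁ ^ 2 * X ^ 2 + 2 * Q ^ 2) + 2 * N₀ * (M₁ * X + Q)) + κ * h =
        (2 * N₀ ^ 2 + 2 * (κ * h) + 2 * Q ^ 2 + 2 * N₀ * Q) + 2 * N₀ * M₁ * X + 2 * M₁ ^ 2 * X ^ 2 := by ring
    rw [hring] at htot
    linarith [htot, hE0, hce, hκh]
  · -- small oscillation
    rw [Set.indicator_of_notMem hbad, mul_zero, zero_mul, zero_mul, mul_zero, mul_zero, add_zero, add_zero, add_zero]
    have hosc : oscFn h (incr u (brownianCPath ω)) < κ₀ / stepSigma := not_le.1 hbad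
    have hS' : ∀ r : ℝ≥0, r ≤ h → |drvK κ (brownianCPath ω) (u + r) - drvK κ (brownianCPath ω) u| ≤ κ₀ := fun r hr ↦ by
      -- adapted from SLERestrictionLocalMartingaleKappa.lean
      have h1 := abs_incr_le_oscFn hr u (brownianCPath ω)
      have : drvK κ (brownianCPath ω) (u + r) - drvK κ (brownianCPath ω) u =
          Real.sqrt κ * ((brownianCPath ω) (u + r) - (brownianCPath ω) u) := by simp only [drvK]; ring
      rw [this, abs_mul, abs_of_nonneg (Real.sqrt_nonneg _)]
      have hle1 := (lt_div_iff₀' hσ).1 (lt_of_le_of_lt h1 hosc) |>.le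
      calc Real.sqrt κ * |(brownianCPath ω) (u + r) - (brownianCPath ω) u|
          ≤ stepSigma * |(brownianCPath ω) (u + r) - (brownianCPath ω) u| :=
            mul_le_mul_of_nonneg_right (sqrt_le_stepSigma hκ) (abs_nonneg _)
        _ ≤ κ₀ := hle1
    obtain ⟨hcz, -⟩ := abs_imgClockK_sub_sub_le (κ := κ) (hA := hA) (hne := hne) (n := n) hu hh0 hS' hh2
    rcases le_or_gt (((u + h : ℝ≥0) : WithTop ℝ≥0)) (imgLocTimeK κ hA hne n ω) with hle | hlt
    · -- interior cell: only the clock error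
      have hM : ΔM = ΔΦ := prod_imgMartK_sub_eq_of_le hle h0
      have hLe : L = Eu * Yh := prod_locMartK_eq_of_le (hle.trans hτT) hT0
      have hcl : |ΔC - d ^ 2 * h| ≤ 2 * h * cellErr n κ₀ h := hcz hle
      have hval : (2 * Mu * ΔM + ΔM ^ 2) * L - κ * ΔC * L - Eu * Yh * (ΔΦ ^ 2 + 2 * Mu * ΔΦ) + κ * h * (Eu * d ^ 2 * Yh) =
          -(κ * (Eu * Yh) * (ΔC - d ^ 2 * h)) := by rw [hM, hLe]; ring
      rw [hval, abs_neg, abs_mul, abs_mul, abs_of_nonneg hκ0', abs_of_nonneg hEY01.1]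
      have : (κ : ℝ) * (Eu * Yh) * |ΔC - d ^ 2 * h| ≤ κ * 1 * (2 * h * cellErr n κ₀ h) :=
        mul_le_mul (mul_le_mul_of_nonneg_left hEY01.2 hκ0') hcl (abs_nonneg _) (by positivity)
      linarith [hE0]
    · -- boundary cell
      rw [Set.indicator_of_mem (show ω ∈ {ω | (u : WithTop ℝ≥0) < imgLocTimeK κ hA hne n ω ∧
        imgLocTimeK κ hA hne n ω < ((u + h : ℝ≥0) : WithTop ℝ≥0)} from ⟨hu, hlt⟩)]
      obtain ⟨-, hbd⟩ := abs_imgMartK_sub_sub_le (κ := κ) hu hh0 hS' hh2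
      obtain ⟨haliveh, e2⟩ := abs_imageDriver_sub_le_of_lt_imgLocTimeK (κ := κ) hu hS' hh2 hh0 le_rfl
      have halive_u := (imgDrvP_eq_of_le hu.le h0).1
      have hΦ : ΔΦ = imageDriver (drvK κ (brownianCPath ω)) A (u + h) - imageDriver (drvK κ (brownianCPath ω)) A u := by
        rw [hΔΦ, imageDrvFnK_of_alive haliveh, imageDrvFnK_of_alive halive_u, imageDriver, imageDriver]; ring
      have hD2 : 25 * (h : ℝ) / (locLevel n / 16) + 2 * κ₀ = D / 2 := by rw [hD]; ring
      have hΔΦ' : |ΔΦ| ≤ D / 2 := by rw [hΦ, ← hD2]; exact e2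
      have hbd' : |ΔM - ΔΦ| ≤ D := hbd
      have hΔM' : |ΔM| ≤ 3 * D / 2 := by
        have := abs_add_le (ΔM - ΔΦ) ΔΦ; rw [sub_add_cancel] at this; linarith
      have p1 : |(2 * Mu * ΔM + ΔM ^ 2) * L| ≤ 3 * N₀ * D + 9 * D ^ 2 / 4 := by
        rw [abs_mul, abs_of_nonneg hL01.1]
        have e1 : |2 * Mu * ΔM + ΔM ^ 2| ≤ 3 * N₀ * D + 9 * D ^ 2 / 4 := by
          have a1 : |2 * Mu * ΔM| ≤ 2 * N₀ * (3 * D / 2) := by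
            rw [abs_mul, abs_mul, abs_two]; exact mul_le_mul (by linarith) hΔM' (abs_nonneg _) (by positivity)
          have a2 : |ΔM ^ 2| ≤ (3 * D / 2) ^ 2 := by
            rw [abs_of_nonneg (sq_nonneg _), ← sq_abs]; exact pow_le_pow_left₀ (abs_nonneg _) hΔM' 2
          calc _ ≤ |2 * Mu * ΔM| + |ΔM ^ 2| := abs_add_le _ _
            _ ≤ 2 * N₀ * (3 * D / 2) + (3 * D / 2) ^ 2 := add_le_add a1 a2
            _ = _ := by ring
        have e0 : 0 ≤ 3 * N₀ * D + 9 * D ^ 2 / 4 := by positivity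
        calc |2 * Mu * ΔM + ΔM ^ 2| * L ≤ (3 * N₀ * D + 9 * D ^ 2 / 4) * 1 := mul_le_mul e1 hL01.2 hL01.1 e0
          _ = _ := mul_one _
      have p3 : |Eu * Yh * (ΔΦ ^ 2 + 2 * Mu * ΔΦ)| ≤ D ^ 2 / 4 + N₀ * D := by
        rw [abs_mul, abs_of_nonneg hEY01.1]
        have e1 : |ΔΦ ^ 2 + 2 * Mu * ΔΦ| ≤ D ^ 2 / 4 + N₀ * D := by
          have a1 : |ΔΦ ^ 2| ≤ (D / 2) ^ 2 := by
            rw [abs_of_nonneg (sq_nonneg _), ← sq_abs]; exact pow_le_pow_left₀ (abs_nonneg _) hΔΦ' 2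
          have a2 : |2 * Mu * ΔΦ| ≤ 2 * N₀ * (D / 2) := by
            rw [abs_mul, abs_mul, abs_two]; exact mul_le_mul (by linarith) hΔΦ' (abs_nonneg _) (by positivity)
          calc _ ≤ |ΔΦ ^ 2| + |2 * Mu * ΔΦ| := abs_add_le _ _
            _ ≤ (D / 2) ^ 2 + 2 * N₀ * (D / 2) := add_le_add a1 a2
            _ = _ := by ring
        have e0 : 0 ≤ D ^ 2 / 4 + N₀ * D := by positivity
        calc Eu * Yh * |ΔΦ ^ 2 + 2 * Mu * ΔΦ| ≤ 1 * (D ^ 2 / 4 + N₀ * D) := mul_le_mul hEY01.2 e1 (abs_nonneg _) zero_le_one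
          _ = _ := one_mul _
      have htot : |(2 * Mu * ΔM + ΔM ^ 2) * L - κ * ΔC * L - Eu * Yh * (ΔΦ ^ 2 + 2 * Mu * ΔΦ) + κ * h * (Eu * d ^ 2 * Yh)| ≤
          (3 * N₀ * D + 9 * D ^ 2 / 4) + κ * h + (D ^ 2 / 4 + N₀ * D) + κ * h :=
        (abs_add_le _ _).trans (add_le_add ((abs_sub _ _).trans (add_le_add ((abs_sub _ _).trans (add_le_add p1 p2)) p3)) p4)
      have hce : 0 ≤ 2 * (κ : ℝ) * h * cellErr n κ₀ h := by positivity
      have hring : (3 * N₀ * D + 9 * D ^ 2 / 4) + κ * h + (D ^ 2 / 4 + N₀ * D) + κ * h =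
          5 / 2 * D ^ 2 + 4 * N₀ * D + 2 * κ * h := by ring
      rw [hring] at htot
      linarith [htot, hce, sq_nonneg D]

end Pathwise

section Registered

/-- **Registered form** (explicit binders) of `brk_frozen_of_not_lt`: after the localising time
`imgLocTimeK n` both `Mⁿ` and the clock `Cⁿ` are frozen. [folklore] -/
theorem brk_frozen_of_not_lt_registered :
    ∀ (κ : ℝ≥0) (A : Set ℂ) (hA : IsStarHull A) (hne : A.Nonempty) (n : ℕ) (u h : ℝ≥0) (ω : ℝ≥0 → ℝ),
      ¬ (u : WithTop ℝ≥0) < imgLocTimeK κ hA hne n ω →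
      imgMartK κ hA hne n (u + h) ω = imgMartK κ hA hne n u ω ∧ imgClockK κ hA hne n (u + h) ω = imgClockK κ hA hne n u ω :=
  fun _ _ _ _ _ _ _ _ h2 ↦ brk_frozen_of_not_lt h2

end Registered

end Summit.CriticalPhenomena.SAWScalingLimit.Theorems.SubseqIdentification.BoundaryAreaLaw

end
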